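import Summits.BirchSwinnertonDyer.BirchSwinnertonDyer.Theses.CountingDoorF2AtThree
import Summits.BirchSwinnertonDyer.Rank1Residual.X1.PadicSigmaThreeExistence
import Summits.BirchSwinnertonDyer.Rank2.CountingDoorKernel
import HarnessLib

/-!
# BirchSwinnertonDyer / CountingDoorF2AtThree — the Mazur–Tate `σ₃` conjunct of the fact pack
# `PublishedInputsAtThree` (stmt-BirchSwinnertonDyer-19482) is a THEOREM of the tree

Route `route-BirchSwinnertonDyer-CountingDoorF2AtThree` (cell bsd-rank2). Its auto-crux
`PublishedInputsAtThree` (item 19482, the route closes MODULO it) is the conjunction, verbatim up to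
unfolding, of four named Literature facts:

1. `Schneider1985_order_charGenerator_odd` (Schneider 1985 / Perrin-Riou; BMS Thm 1.7, `p > 2`);
2. `mazur_tate_sigma_exists_odd` (Mazur–Tate 1991 Thm 3.1: the Mazur–Tate `σ`-pair exists at every odd
   good ordinary prime — the only content beyond the tree's Blakestad–Grant theorem is `p = 3`);
3. `even_selmerRank_sub_torsionRank_iff` (Dokchitser–Dokchitser 2010, `p`-parity in counting form);
4. `∀ W κ γ f, skinner_urban_main_conjecture W 3 …` (Skinner–Urban 2014 Thm 3.6.9).

Conjunct 2 is PROVED in the tree: `Summit.BirchSwinnertonDyer.Rank1Residual.X1.PadicSigmaThree.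
mazur_tate_sigma_exists_odd_holds` (`Summits/BirchSwinnertonDyer/Rank1Residual/X1/PadicSigmaThreeExistence.lean`,
cell b2b-bsdres unit x1a, 2026-08-22: Blakestad–Grant's universal `3`-adic sigma function for the
`a₂`-family `y² = x³ + a₂x² + a₄x + a₆` over `R̂₃ = ℤ[a₂,a₄,a₆][1/a₂]^∧₃`, Frobenius lift from the
canonical `3`-isogeny, Dwork/Hazewinkel integrality, Thm 15 specialisation, and the reduction of the
minimal model to an integral `a₂`-model by `(1, 0, -a₁/2, -a₃/2)`; axioms `propext`, `Classical.choice`,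
`Quot.sound`). This file records the consequence for the route:

* `mazurTateSigmaConjunct_publishedInputsAtThree` — conjunct 2 of `PublishedInputsAtThree`, as typed
  there, holds;
* `publishedInputsAtThree_of_facts` — **`PublishedInputsAtThree` follows from the THREE named facts
  1, 3, 4 alone**; `publishedInputsAtThree_iff_facts` — and is equivalent to their conjunction;
* `doorKernelAtThree_of_facts` — the per-member door kernel at `3` (the consequent of the route's
  `DoorKernelAtThree`, closed by `Theorems.doorKernelAtThree`) from facts 1 and 4 only
  (`Rank2.doorKernel_at_three` with its `σ`-binder discharged).

So the route's fact pack at `p = 3` is, in substance, {Schneider–Perrin-Riou, Dokchitser–Dokchitser,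
Skinner–Urban}: three published theorems, none of them about the `3`-adic sigma function. Nothing here
reads an analytic rank (B1 honesty: bookkeeping on the fact pack; no S0 motion).

Pure proof file (`--supports stmt-BirchSwinnertonDyer-19482`): no definition, no named fact, no `sorry`.
-/

set_option linter.dupNamespace false

namespace Summit.BirchSwinnertonDyer.BirchSwinnertonDyer.Theorems

open Summit.BirchSwinnertonDyer.BirchSwinnertonDyer.Theses.CountingDoorF2AtThree
open Literature.NumberTheory.EllipticCurves

/-- **Conjunct 2 of `PublishedInputsAtThree` holds**: for every globally minimal elliptic `W/ℚ` and
every prime `p ≠ 2` of good ordinary reduction, a Mazur–Tate sigma pair of `W ⊗ ℚ_p` exists — the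
tree theorem `X1.PadicSigmaThree.mazur_tate_sigma_exists_odd_holds` (Mazur–Tate 1991 Thm 3.1 /
Mazur–Stein–Tate 2006 Thm 1.3, existence half; `p ≥ 5` Blakestad–Grant, `p = 3` the x1a tower).
[cite: MazurSteinTate2006, Thm. 1.3] [cite: BlakestadGrant2023, Thm. 1] -/
theorem mazurTateSigmaConjunct_publishedInputsAtThree :
    ∀ (W : WeierstrassCurve ℚ) [W.IsElliptic] [W.IsGloballyMinimal] (p : ℕ) [Fact p.Prime], p ≠ 2 →
      W.HasGoodReductionAtPrime p → ¬ (p : ℤ) ∣ W.frobeniusTrace p →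
        ∃ σ : PowerSeries ℚ_[p], ∃ c : ℚ_[p], (W.baseChange ℚ_[p]).IsMazurTateSigmaPair σ c :=
  fun W _ _ p _ hp hgood hord ↦
    Summit.BirchSwinnertonDyer.Rank1Residual.X1.PadicSigmaThree.mazur_tate_sigma_exists_odd_holds W p hp
      hgood hord

/-- **`PublishedInputsAtThree` from three named facts** (Schneider–Perrin-Riou at odd `p`,
Dokchitser–Dokchitser `p`-parity, Skinner–Urban at `3`): the fourth conjunct, existence of the
Mazur–Tate `σ`-pair at odd good ordinary primes, is supplied by the tree theorem
`X1.PadicSigmaThree.mazur_tate_sigma_exists_odd_holds`. [cite: MazurSteinTate2006, Thm. 1.3]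
[cite: SkinnerUrban2014, Thm. 3.6.9] -/
theorem publishedInputsAtThree_of_facts (hS : Schneider1985_order_charGenerator_odd)
    (hDD : even_selmerRank_sub_torsionRank_iff)
    (hSU : ∀ (W : WeierstrassCurve ℚ) [W.IsElliptic] [W.IsGloballyMinimal]
      (κ : ZpExtension ℚ 3) (γ : Field.absoluteGaloisGroup ℚ) {N : ℕ} [NeZero N]
      (f : CuspForm (CongruenceSubgroup.Gamma0 N) 2),
      skinner_urban_main_conjecture W 3 (κ := κ) (γ := γ) (f := f)) :
    PublishedInputsAtThree :=
  ⟨hS, Summit.BirchSwinnertonDyer.Rank1Residual.X1.PadicSigmaThree.mazur_tate_sigma_exists_odd_holds,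
    hDD, hSU⟩

/-- **`PublishedInputsAtThree` is EQUIVALENT to the conjunction of the three named facts**
`Schneider1985_order_charGenerator_odd ∧ even_selmerRank_sub_torsionRank_iff ∧ (∀ W κ γ f,
skinner_urban_main_conjecture W 3 …)` — its `σ₃` conjunct being a theorem. [cite: MazurSteinTate2006,
Thm. 1.3] [cite: SkinnerUrban2014, Thm. 3.6.9] -/
theorem publishedInputsAtThree_iff_facts :
    PublishedInputsAtThree ↔
      (Schneider1985_order_charGenerator_odd ∧ even_selmerRank_sub_torsionRank_iff ∧
        ∀ (W : WeierstrassCurve ℚ) [W.IsElliptic] [W.IsGloballyMinimal]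
          (κ : ZpExtension ℚ 3) (γ : Field.absoluteGaloisGroup ℚ) {N : ℕ} [NeZero N]
          (f : CuspForm (CongruenceSubgroup.Gamma0 N) 2),
          skinner_urban_main_conjecture W 3 (κ := κ) (γ := γ) (f := f)) :=
  ⟨fun h ↦ ⟨h.1, h.2.2.1, h.2.2.2⟩, fun h ↦ publishedInputsAtThree_of_facts h.1 h.2.1 h.2.2⟩

/-- **The per-member door kernel at `p = 3` from Schneider–Perrin-Riou and Skinner–Urban only**
(the consequent of the route's `DoorKernelAtThree` with its fact-pack antecedent replaced by the two
facts it genuinely consumes): for a globally minimal elliptic `W/ℚ`, good ordinary at `3`, with `ρ̄₃`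
irreducible, an auxiliary multiplicative prime `ℓ ≠ 3` with `3 ∤ v_ℓ(Δ_min)`, Schneider's conjecture at
`3` for every canonical datum, `#Sel₃(W) = 9` and `rank ≥ 2`: `rank = 2`, `Ш(W)[3^∞] = 0` and
`ord_{T=0} L₃(f, α; T) = 2` for every newform `f` of `W`. This is
`Summit.BirchSwinnertonDyer.Rank2.doorKernel_at_three` with the Mazur–Tate-`σ` binder discharged by
`X1.PadicSigmaThree.mazur_tate_sigma_exists_odd_holds`. [cite: SkinnerUrban2014, Thm. 3.6.9]
[cite: MazurSteinTate2006, Thm. 1.3] -/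
theorem doorKernelAtThree_of_facts (hS : Schneider1985_order_charGenerator_odd)
    (hSU : ∀ (W : WeierstrassCurve ℚ) [W.IsElliptic] [W.IsGloballyMinimal]
      (κ : ZpExtension ℚ 3) (γ : Field.absoluteGaloisGroup ℚ) {N : ℕ} [NeZero N]
      (f : CuspForm (CongruenceSubgroup.Gamma0 N) 2),
      skinner_urban_main_conjecture W 3 (κ := κ) (γ := γ) (f := f))
    (W : WeierstrassCurve ℚ) [W.IsElliptic] [W.IsGloballyMinimal]
    (hord : IsOrdinaryAt W 3) (hirr : W.HasIrreducibleModPGaloisRep 3)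
    (haux : ∃ ℓ : ℕ, ∃ _ : Fact ℓ.Prime, ℓ ≠ 3 ∧ W.HasMultiplicativeReductionAtPrime ℓ ∧
      ¬ 3 ∣ padicValInt ℓ W.minimalDiscriminantInt)
    (hR : ∀ Dh : WeierstrassCurve.PAdicHeightData W 3, Dh.IsCanonical → WeierstrassCurve.SchneiderConjecture Dh)
    (hSel : Nat.card (W.selmerGroup 3) = 3 ^ 2) (h2 : 2 ≤ W.mordellWeilRank) :
    W.mordellWeilRank = 2 ∧ AddCommGroup.primaryComponent W.sha 3 = ⊥ ∧
      ∀ ⦃N : ℕ⦄ [NeZero N] (f : CuspForm (CongruenceSubgroup.Gamma0 N) 2),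
        Literature.NumberTheory.EllipticCurves.ModularForms.IsNewformOf W f →
          (padicLFunction f (unitRoot W 3 : ℚ_[3])).order = 2 :=
  Summit.BirchSwinnertonDyer.Rank2.doorKernel_at_three hS
    Summit.BirchSwinnertonDyer.Rank1Residual.X1.PadicSigmaThree.mazur_tate_sigma_exists_odd_holds hSU W
    hord hirr haux hR hSel h2

end Summit.BirchSwinnertonDyer.BirchSwinnertonDyer.Theorems
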